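import Summits.Schanuel.Schanuel.Theorems.DiophantineDichotomyApproximationPropertyDefs
import Summits.Schanuel.Schanuel.Theorems.DiophantineDichotomyApproximationPropertyOrbitClusterBoundLemmas
import Summits.Schanuel.Schanuel.Theorems.DiophantineDichotomyApproximationPropertyOrbitClusterBoundArith

/-!
# The lever `OrbitClusterBound` of line `orbit-interpolation-determinant` (crux `ApproximationProperty`, stmt-Schanuel-6117)

Registered stub `stub_orbitClusterBound : OrbitClusterBound` (statement in the line's definitions
module `DiophantineDichotomyApproximationPropertyDefs`), PROVED: conjugate clustering of an algebraic
point costs `k^{1+1/t}`, paid in the INTERPOLATION degree. For `t ≥ 1` (with `c₀ = 1/4`,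
`C = 2t + 2`): if `K` is a number field, `β ∈ Kᵗ`, the monomials of total degree `≤ δ` in `β` span
`K` over `ℚ`, and `k` distinct complex embeddings put `σᵢ(β)` in the sup-ball of radius `r ≤ 1`
about `x ∈ ℂᵗ`, then
`(¼ k^{1+1/t} − k) · log(1/r) ≤ C · (δ · h_K(1 : β) + D log(D+1) + k δ log(2 + ‖x‖) + k log(δ+2))`,
`D = [K : ℚ]`, `h_K` = Mathlib's `Height.logHeight` relative to `K`.

## Proof (Galois-orbit interpolation determinant)

Choose a monomial basis `β^{αⱼ}`, `|αⱼ| ≤ δ` (`exists_monomial_basis`), `n ∈ ℕ` with `nβ`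
integral, the integral tuple `x̲ = (n, nβ₁, …, nβ_t)` with ideal `𝔞 = (x̲)`, and
`yⱼ = n^δ β^{αⱼ} ∈ 𝔞^δ`. LOWER bound: `N(𝔞)^δ = N(𝔞^δ) ≤ |det(σ_a(yⱼ))|`
(`absNorm_le_norm_det_embeddings`: discriminant through the fractional ideal `𝔞^δ`). UPPER bound:
the rows of the `k` close embeddings are exact Taylor sums `∑_γ u_a^γ w_γ` about `x`
(`prod_pow_eq_sum_box`), so `norm_det_le_of_cluster` with `∑|γᵢ| ≥ ¼k^{1+1/t} − k` over distinct
multi-indices (`quarter_rpow_sub_le_sum_tdeg`) gives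
`|det| ≤ (δ+1)^{tk} r^m D! (n(2+‖x‖)²)^{δk} ∏_{a ∉ S} (maxᵢ|σ_a x̲ᵢ|)^δ`. Since
`∏_a maxᵢ|σ_a x̲ᵢ| = N(𝔞) H_K(x̲)` (`absNorm_mul_mulHeight_eq_prod_embeddings`) and
`H_K(x̲) = H_K(1 : β)`, the norm `N(𝔞)^δ` cancels EXACTLY (no factor `D` is lost) and
`m log(1/r) ≤ kt log(δ+1) + log D! + 2kδ log(2+‖x‖) + δ h_K(1:β)`. Everything is proved. -/

open Finset Matrix NumberField Module Height
open scoped nonZeroDivisors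

-- `Summit.Schanuel.Schanuel.…` is the mandated summit/sub-problem namespace (single-conjunct summit):
set_option linter.dupNamespace false

noncomputable section

namespace Summit.Schanuel.Schanuel.Cruxes.ApproximationProperty.OrbitInterpolationDeterminant


/-- Integer scaling of finitely many elements of a number field. -/
theorem exists_nat_mul_isIntegral {K : Type*} [Field K] [NumberField K] {t : ℕ} (β : Fin t → K) :
    ∃ n : ℕ, 0 < n ∧ ∀ l, IsIntegral ℤ ((n : K) * β l) := by
  classical
  obtain ⟨y, hy0, hy⟩ := exists_integral_multiples ℤ ℚ (Finset.univ.image β)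
  refine ⟨y.natAbs, Int.natAbs_pos.mpr hy0, fun l => ?_⟩
  have h := hy (β l) (Finset.mem_image_of_mem β (Finset.mem_univ l))
  rw [zsmul_eq_mul] at h
  rcases Int.natAbs_eq y with hc | hc
  · have : ((y.natAbs : ℕ) : K) = (y : K) := by rw [← Int.cast_natCast, ← hc]
    rw [this]; exact h
  · have hy' : (y : K) = -((y.natAbs : ℕ) : K) := by rw [← Int.cast_natCast, ← Int.cast_neg, ← hc]
    have : ((y.natAbs : ℕ) : K) = -(y : K) := by rw [hy', neg_neg]
    rw [this, neg_mul]
    exact h.neg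

/-- **The lever** (stub `stub_orbitClusterBound` of line `orbit-interpolation-determinant`). -/
theorem stub_orbitClusterBound : OrbitClusterBound := by
  intro t ht
  refine ⟨1 / 4, by norm_num, 2 * t + 2, by positivity, ?_⟩
  intro K _ _ β δ k σ x r hspan hσ hr0 hr1 hclose
  classical
  -- § indices
  set D : ℕ := finrank ℚ K with hD
  let ι₀ := Free.ChooseBasisIndex ℤ (𝓞 K)
  have hcardι₀ : Fintype.card ι₀ = D := by
    rw [hD, ← finrank_eq_card_chooseBasisIndex, RingOfIntegers.rank]
  have hcardE : Fintype.card ι₀ = Fintype.card (K →ₐ[ℚ] ℂ) := by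
    rw [hcardι₀, hD, AlgHom.card]
  let eE : ι₀ ≃ (K →ₐ[ℚ] ℂ) := Fintype.equivOfCardEq hcardE
  -- § monomial basis
  obtain ⟨α, hαdeg, hαli⟩ := exists_monomial_basis β hspan ι₀ hcardι₀
  -- § integer scaling and the integral tuple `xI = (n, nβ₁, …, nβ_t)`
  obtain ⟨n, hn0, hnint⟩ := exists_nat_mul_isIntegral β
  have hnK : ((n : K)) ≠ 0 := by exact_mod_cast hn0.ne'
  have hnR : (0 : ℝ) < n := by exact_mod_cast hn0
  have hn1 : (1 : ℝ) ≤ n := by exact_mod_cast hn0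
  have hnI : IsIntegral ℤ ((n : K)) := by
    simpa using (isIntegral_algebraMap (R := ℤ) (A := K) (x := (n : ℤ)))
  let xI : Fin (t + 1) → 𝓞 K :=
    Fin.cons ⟨(n : K), (mem_integralClosure_iff ℤ K).mpr hnI⟩
      (fun l => ⟨(n : K) * β l, (mem_integralClosure_iff ℤ K).mpr (hnint l)⟩)
  have hxI0 : ((xI 0 : 𝓞 K) : K) = n := by simp [xI]
  have hxIs : ∀ l : Fin t, ((xI l.succ : 𝓞 K) : K) = n * β l := by intro l; simp [xI]
  have hxI_ne : xI ≠ 0 := by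
    intro h
    have h0 := congrFun h 0
    have : ((xI 0 : 𝓞 K) : K) = 0 := by rw [h0]; rfl
    rw [hxI0] at this
    exact hnK this
  set 𝔞 : Ideal (𝓞 K) := Ideal.span (Set.range xI) with h𝔞def
  have h𝔞0 : 𝔞 ≠ ⊥ := by
    intro h
    have hmem : xI 0 ∈ 𝔞 := Ideal.subset_span ⟨0, rfl⟩
    rw [h, Ideal.mem_bot] at hmem
    have : ((xI 0 : 𝓞 K) : K) = 0 := by rw [hmem]; rfl
    rw [hxI0] at this
    exact hnK this
  -- § the basis `yK j = n^δ β^{α j}` lies in `𝔞^δ`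
  let yK : ι₀ → K := fun j => (n : K) ^ δ * ∏ l, β l ^ α j l
  have hyKmem : ∀ j, ∃ y' ∈ 𝔞 ^ δ, algebraMap (𝓞 K) K y' = yK j := by
    intro j
    refine ⟨xI 0 ^ (δ - ∑ l, α j l) * ∏ l, xI l.succ ^ α j l, ?_, ?_⟩
    · have h1 : xI 0 ^ (δ - ∑ l, α j l) ∈ 𝔞 ^ (δ - ∑ l, α j l) :=
        Ideal.pow_mem_pow (Ideal.subset_span (Set.mem_range_self (f := xI) 0) : xI 0 ∈ 𝔞) _
      have h2 : ∏ l, xI l.succ ^ α j l ∈ 𝔞 ^ (∑ l, α j l) := by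
        rw [← Finset.prod_pow_eq_pow_sum]
        exact Ideal.prod_mem_prod fun l _ => Ideal.pow_mem_pow (Ideal.subset_span (Set.mem_range_self (f := xI) l.succ) : xI l.succ ∈ 𝔞) _
      have h3 := Ideal.mul_mem_mul h1 h2
      rwa [← pow_add, Nat.sub_add_cancel (hαdeg j)] at h3
    · simp only [map_mul, map_pow, map_prod, yK]
      have e0 : algebraMap (𝓞 K) K (xI 0) = n := hxI0
      have es : ∀ l, algebraMap (𝓞 K) K (xI l.succ) = n * β l := hxIs
      rw [e0]
      simp_rw [es, mul_pow, Finset.prod_mul_distrib, Finset.prod_pow_eq_pow_sum]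
      rw [← mul_assoc, ← pow_add, Nat.sub_add_cancel (hαdeg j)]
  have h𝔞δ : ((𝔞 ^ δ : Ideal (𝓞 K)) : FractionalIdeal (𝓞 K)⁰ K) ≠ 0 :=
    FractionalIdeal.coeIdeal_ne_zero.mpr (pow_ne_zero δ (by simpa using h𝔞0))
  let I : (FractionalIdeal (𝓞 K)⁰ K)ˣ := Units.mk0 _ h𝔞δ
  have hI : (I : FractionalIdeal (𝓞 K)⁰ K) = ((𝔞 ^ δ : Ideal (𝓞 K)) : FractionalIdeal (𝓞 K)⁰ K) :=
    Units.val_mk0 h𝔞δ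
  have hyKI : ∀ j, yK j ∈ (I : FractionalIdeal (𝓞 K)⁰ K) := by
    intro j
    rw [hI, FractionalIdeal.mem_coeIdeal]
    exact hyKmem j
  have hliK : LinearIndependent ℚ yK := by
    have hq : ((n : ℚ)) ^ δ ≠ 0 := pow_ne_zero _ (by exact_mod_cast hn0.ne')
    have h := hαli.units_smul (fun _ => Units.mk0 (((n : ℚ)) ^ δ) hq)
    convert h using 1
    funext j
    simp only [Pi.smul_apply', Units.smul_mk0, yK, Algebra.smul_def, map_pow, map_natCast]
  -- § LOWER BOUND for the interpolation determinant
  set W : Matrix ι₀ ι₀ ℂ := Matrix.of fun a j => eE a (yK j) with hW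
  have hlow := absNorm_le_norm_det_embeddings I yK hyKI hliK eE
  have habsI : (FractionalIdeal.absNorm (I : FractionalIdeal (𝓞 K)⁰ K) : ℝ) =
      (Ideal.absNorm 𝔞 : ℝ) ^ δ := by
    rw [hI, FractionalIdeal.coeIdeal_absNorm, map_pow]
    push_cast
    rfl
  rw [habsI] at hlow
  -- hlow : N(𝔞)^δ ≤ ‖det W‖
  -- § UPPER BOUND: clustered Taylor rows
  let z : ι₀ → Fin t → ℂ := fun a l => eE a (β l)
  let σ' : Fin k → (K →ₐ[ℚ] ℂ) := fun i => (σ i).toRatAlgHom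
  have hσ' : Function.Injective σ' := fun i i' h => hσ (by
    have := congrArg (fun f : K →ₐ[ℚ] ℂ => (f : K →+* ℂ)) h
    simpa [σ'] using this)
  let emb : Fin k → ι₀ := fun i => eE.symm (σ' i)
  have hemb : Function.Injective emb := fun i i' h => hσ' (eE.symm.injective h)
  set S : Finset ι₀ := Finset.univ.image emb with hSdef
  have hScard : S.card = k := by
    rw [hSdef, Finset.card_image_of_injective _ hemb, Finset.card_univ, Fintype.card_fin]
  have hzS : ∀ a ∈ S, ‖z a - x‖ ≤ r := by
    intro a ha
    rw [hSdef, Finset.mem_image] at ha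
    obtain ⟨i, -, rfl⟩ := ha
    have hz : z (emb i) = fun j => σ i (β j) := by
      funext j
      simp [z, emb, σ']
    rw [hz]
    exact hclose i
  set Γ : Finset (Fin t → ℕ) := Fintype.piFinset fun _ : Fin t => Finset.range (δ + 1) with hΓdef
  have hΓne : Γ.Nonempty := ⟨fun _ => 0, by
    rw [hΓdef, Fintype.mem_piFinset]; intro; simp⟩
  have hΓcard : (Γ.card : ℝ) = ((δ : ℝ) + 1) ^ t := by
    rw [hΓdef, Fintype.card_piFinset, Finset.prod_const, Finset.card_range, Finset.card_univ,
      Fintype.card_fin]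
    push_cast; ring
  let u : ι₀ → (Fin t → ℕ) → ℂ := fun a γ => ∏ l, (z a l - x l) ^ γ l
  let w : (Fin t → ℕ) → ι₀ → ℂ := fun γ j =>
    (n : ℂ) ^ δ * ∏ l, ((Nat.choose (α j l) (γ l) : ℂ) * x l ^ (α j l - γ l))
  let deg : (Fin t → ℕ) → ℕ := fun γ => ∑ l, γ l
  set c2 : ℝ := ((2 + ‖x‖) ^ 2) ^ δ with hc2
  have hc2pos : 0 < c2 := by positivity
  have hc21 : 1 ≤ c2 := one_le_pow₀ (by nlinarith [norm_nonneg x])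
  set B : ℝ := (n : ℝ) ^ δ * c2 with hBdef
  have hB0 : 0 ≤ B := by positivity
  let Rv : ι₀ → ℝ := fun a => ⨆ i : Fin (t + 1), ‖eE a ((xI i : 𝓞 K) : K)‖
  have hRv_le : ∀ a i, ‖eE a ((xI i : 𝓞 K) : K)‖ ≤ Rv a := fun a i =>
    le_ciSup (Finite.bddAbove_range fun i : Fin (t + 1) => ‖eE a ((xI i : 𝓞 K) : K)‖) i
  have hRv_n : ∀ a, (n : ℝ) ≤ Rv a := fun a => by
    have h := hRv_le a 0
    rwa [hxI0, map_natCast, Complex.norm_natCast] at h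
  have hRv_pos : ∀ a, 0 < Rv a := fun a => hnR.trans_le (hRv_n a)
  have hRv_z : ∀ a l, (n : ℝ) * ‖z a l‖ ≤ Rv a := fun a l => by
    have h := hRv_le a l.succ
    rwa [hxIs, map_mul, map_natCast, norm_mul, Complex.norm_natCast] at h
  let R : ι₀ → ℝ := fun a => Rv a ^ δ
  have hR0 : ∀ a, 0 ≤ R a := fun a => pow_nonneg (hRv_pos a).le _
  set mreal : ℝ := 1 / 4 * (k : ℝ) ^ (1 + 1 / (t : ℝ)) - k with hmreal
  set m : ℕ := ⌈mreal⌉₊ with hmdef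
  -- the rows of W are Taylor sums
  have hαl : ∀ j l, α j l ≤ δ := fun j l =>
    (Finset.single_le_sum (fun l _ => Nat.zero_le (α j l)) (Finset.mem_univ l)).trans (hαdeg j)
  have hWentry : ∀ a j, W a j = (n : ℂ) ^ δ * ∏ l, z a l ^ α j l := by
    intro a j
    simp only [hW, Matrix.of_apply, yK, map_mul, map_pow, map_natCast, map_prod, z]
  have hrow : ∀ a ∈ S, W a = ∑ γ ∈ Γ, u a γ • w γ := by
    intro a _
    funext j
    rw [Finset.sum_apply, hWentry a j, prod_pow_eq_sum_box (z a) x (α j) (hαl j), Finset.mul_sum]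
    refine Finset.sum_congr rfl fun γ _ => ?_
    simp only [Pi.smul_apply, smul_eq_mul, u, w]
    ring
  have hu : ∀ a ∈ S, ∀ γ ∈ Γ, ‖u a γ‖ ≤ r ^ deg γ := fun a ha γ _ =>
    norm_prod_sub_pow_le (z a) x γ (hzS a ha)
  have hw : ∀ γ ∈ Γ, ∀ j, ‖w γ j‖ ≤ B := by
    intro γ _ j
    simp only [w, norm_mul, norm_pow, Complex.norm_natCast, hBdef]
    exact mul_le_mul_of_nonneg_left (norm_prod_choose_mul_pow_le x (α j) γ (hαdeg j))
      (by positivity)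
  have hWbd : ∀ a ∉ S, ∀ j, ‖W a j‖ ≤ R a := by
    intro a _ j
    rw [hWentry a j, norm_mul, norm_pow, Complex.norm_natCast, norm_prod]
    simp_rw [norm_pow]
    -- n^δ ∏ ‖z‖^α = n^(δ-|α|) ∏ (n‖z‖)^α ≤ Rv^(δ-|α|) ∏ Rv^α = Rv^δ
    have hsplit : (n : ℝ) ^ δ * ∏ l, ‖z a l‖ ^ α j l =
        (n : ℝ) ^ (δ - ∑ l, α j l) * ∏ l, ((n : ℝ) * ‖z a l‖) ^ α j l := by
      simp_rw [mul_pow, Finset.prod_mul_distrib, Finset.prod_pow_eq_pow_sum]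
      rw [← mul_assoc, ← pow_add, Nat.sub_add_cancel (hαdeg j)]
    rw [hsplit]
    calc (n : ℝ) ^ (δ - ∑ l, α j l) * ∏ l, ((n : ℝ) * ‖z a l‖) ^ α j l
        ≤ Rv a ^ (δ - ∑ l, α j l) * ∏ l, Rv a ^ α j l := by
          refine mul_le_mul (pow_le_pow_left₀ hnR.le (hRv_n a) _)
            (Finset.prod_le_prod (fun l _ => pow_nonneg (mul_nonneg hnR.le (norm_nonneg _)) _)
              fun l _ => pow_le_pow_left₀ (mul_nonneg hnR.le (norm_nonneg _)) (hRv_z a l) _)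
            (Finset.prod_nonneg fun l _ => pow_nonneg (mul_nonneg hnR.le (norm_nonneg _)) _)
            (pow_nonneg (hRv_pos a).le _)
      _ = R a := by
          simp only [R]
          rw [Finset.prod_pow_eq_pow_sum, ← pow_add, Nat.sub_add_cancel (hαdeg j)]
  have hm : ∀ p : ι₀ → (Fin t → ℕ), (∀ a ∈ S, p a ∈ Γ) → Set.InjOn p S →
      m ≤ ∑ a ∈ S, deg (p a) := by
    intro p _ hinj
    have hT := quarter_rpow_sub_le_sum_tdeg ht (S.image p)
    rw [Finset.card_image_of_injOn hinj, hScard, Finset.sum_image hinj] at hT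
    rw [hmdef]
    refine Nat.ceil_le.mpr ?_
    rw [hmreal]
    have e : ((∑ a ∈ S, deg (p a) : ℕ) : ℝ) = ∑ a ∈ S, ((∑ l, p a l : ℕ) : ℝ) := by
      simp [deg]
    rw [e]
    exact hT
  have hup := norm_det_le_of_cluster W S Γ hΓne u w deg r B R m hr0.le hr1 hB0 hR0
    hrow hu hw hWbd hm
  rw [hScard] at hup
  rw [← hW] at hlow
  -- § the archimedean product `A = ∏ₐ Rv a = N(𝔞) · H_K(xI)` and `H_K(xI) = H_K(1 : β)`
  set A : ℝ := ∏ a, Rv a with hAdef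
  have hApos : 0 < A := Finset.prod_pos fun a _ => hRv_pos a
  have hxK_smul : (fun i => ((xI i : 𝓞 K) : K)) = (n : K) • (Fin.cons (1 : K) β : Fin (t + 1) → K) := by
    funext i
    refine Fin.cases ?_ (fun l => ?_) i
    · rw [hxI0]; simp
    · rw [hxIs l]; simp
  have hH : mulHeight (fun i => ((xI i : 𝓞 K) : K)) = mulHeight (Fin.cons (1 : K) β : Fin (t + 1) → K) := by
    rw [hxK_smul, mulHeight_smul_eq_mulHeight _ hnK]
  -- reindex embeddings along `eE` composed with `RingHom.equivRatAlgHom`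
  let ee : ι₀ ≃ (K →+* ℂ) := eE.trans (RingHom.equivRatAlgHom).symm
  have hee : ∀ a, ∀ y : K, (ee a) y = (eE a) y := fun a y => rfl
  have hprodA : ∏ φ : K →+* ℂ, (⨆ i, ‖φ ((xI i : 𝓞 K) : K)‖) = A := by
    rw [hAdef]
    refine (Fintype.prod_equiv ee (fun a => Rv a) (fun φ => ⨆ i, ‖φ ((xI i : 𝓞 K) : K)‖) ?_).symm
    intro a
    simp only [Rv, hee]
  have hNA0 : (Ideal.absNorm 𝔞 : ℝ) * mulHeight (fun i => ((xI i : 𝓞 K) : K)) = A := by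
    rw [absNorm_mul_mulHeight_eq_prod_embeddings xI hxI_ne, hprodA]
  set H : ℝ := mulHeight (Fin.cons (1 : K) β : Fin (t + 1) → K) with hHdef
  have hH1 : 1 ≤ H := one_le_mulHeight _
  have hHpos : 0 < H := one_pos.trans_le hH1
  have hNA : (Ideal.absNorm 𝔞 : ℝ) * H = A := by
    rw [← hNA0, hH]
  -- § N(𝔞) > 0
  have hNpos : 0 < (Ideal.absNorm 𝔞 : ℝ) := by
    have : Ideal.absNorm 𝔞 ≠ 0 := by
      rw [Ne, Ideal.absNorm_eq_zero_iff]; exact h𝔞0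
    positivity
  -- § B^k ∏_{a ∉ S} R a ≤ c2^k A^δ
  have hBR : ∀ a, B ≤ R a * c2 := fun a => by
    rw [hBdef]
    exact mul_le_mul_of_nonneg_right (pow_le_pow_left₀ hnR.le (hRv_n a) _) hc2pos.le
  have hprodR : ∏ a, R a = A ^ δ := by
    rw [hAdef, ← Finset.prod_pow]
  have htail : B ^ k * ∏ a ∈ univ.filter (· ∉ S), R a ≤ c2 ^ k * A ^ δ := by
    have h1 : B ^ k ≤ (∏ a ∈ S, R a) * c2 ^ k := by
      rw [← hScard, ← Finset.prod_const, ← Finset.prod_const, ← Finset.prod_mul_distrib]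
      exact Finset.prod_le_prod (fun a _ => hB0) fun a _ => hBR a
    have h2 : (∏ a ∈ S, R a) * ∏ a ∈ univ.filter (· ∉ S), R a = ∏ a, R a := by
      rw [← Finset.prod_filter_mul_prod_filter_not univ (· ∈ S)]
      congr 1
      exact Finset.prod_congr (by ext a; simp) fun _ _ => rfl
    have h3 : 0 ≤ ∏ a ∈ univ.filter (· ∉ S), R a := Finset.prod_nonneg fun a _ => hR0 a
    calc B ^ k * ∏ a ∈ univ.filter (· ∉ S), R a
        ≤ ((∏ a ∈ S, R a) * c2 ^ k) * ∏ a ∈ univ.filter (· ∉ S), R a :=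
          mul_le_mul_of_nonneg_right h1 h3
      _ = c2 ^ k * ((∏ a ∈ S, R a) * ∏ a ∈ univ.filter (· ∉ S), R a) := by ring
      _ = c2 ^ k * A ^ δ := by rw [h2, hprodR]
  -- § combine: 1 ≤ Γ^k r^m D! c2^k H^δ
  have hmain : (Ideal.absNorm 𝔞 : ℝ) ^ δ ≤
      (Γ.card : ℝ) ^ k * r ^ m * (Fintype.card ι₀).factorial * (c2 ^ k * A ^ δ) := by
    refine hlow.trans (hup.trans ?_)
    have h0 : 0 ≤ (Γ.card : ℝ) ^ k * r ^ m * (Fintype.card ι₀).factorial := by positivity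
    calc (Γ.card : ℝ) ^ k * r ^ m * (Fintype.card ι₀).factorial * B ^ k *
          ∏ a ∈ univ.filter (· ∉ S), R a
        = ((Γ.card : ℝ) ^ k * r ^ m * (Fintype.card ι₀).factorial) *
            (B ^ k * ∏ a ∈ univ.filter (· ∉ S), R a) := by ring
      _ ≤ _ := mul_le_mul_of_nonneg_left htail h0
  rw [← hNA, mul_pow, hcardι₀] at hmain
  set Q : ℝ := (Γ.card : ℝ) ^ k * (D.factorial : ℝ) * c2 ^ k * H ^ δ with hQdef
  have hQpos : 0 < Q := by positivity
  have hone : 1 ≤ r ^ m * Q := by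
    have hNδ : 0 < (Ideal.absNorm 𝔞 : ℝ) ^ δ := pow_pos hNpos δ
    have : (Ideal.absNorm 𝔞 : ℝ) ^ δ * 1 ≤ (Ideal.absNorm 𝔞 : ℝ) ^ δ * (r ^ m * Q) := by
      rw [mul_one]
      calc (Ideal.absNorm 𝔞 : ℝ) ^ δ
          ≤ (Γ.card : ℝ) ^ k * r ^ m * (D.factorial : ℝ) *
              (c2 ^ k * ((Ideal.absNorm 𝔞 : ℝ) ^ δ * H ^ δ)) := hmain
        _ = (Ideal.absNorm 𝔞 : ℝ) ^ δ * (r ^ m * Q) := by rw [hQdef]; ring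
    exact le_of_mul_le_mul_left this hNδ
  -- § logarithms
  have hlogr : 0 ≤ Real.log (1 / r) := Real.log_nonneg (by rw [le_div_iff₀ hr0]; linarith)
  have hlog1 : (m : ℝ) * Real.log (1 / r) ≤ Real.log Q := by
    have h := Real.log_le_log one_pos hone
    rw [Real.log_one, Real.log_mul (pow_pos hr0 m).ne' hQpos.ne', Real.log_pow] at h
    rw [one_div, Real.log_inv]
    linarith
  have hΓ1 : (1 : ℝ) ≤ Γ.card := by exact_mod_cast hΓne.card_pos
  have hD1 : 1 ≤ D := Module.finrank_pos
  have e1 : Real.log ((Γ.card : ℝ) ^ k) = k * (t * Real.log ((δ : ℝ) + 1)) := by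
    rw [Real.log_pow, hΓcard, Real.log_pow]
  have e2 : Real.log (c2 ^ k) = k * (δ * (2 * Real.log (2 + ‖x‖))) := by
    rw [Real.log_pow, hc2, Real.log_pow, Real.log_pow]; push_cast; ring
  have e3 : Real.log (H ^ δ) = δ * Real.log H := Real.log_pow _ _
  have hne1 : (Γ.card : ℝ) ^ k ≠ 0 := by positivity
  have hne2 : (D.factorial : ℝ) ≠ 0 := by positivity
  have hne3 : c2 ^ k ≠ 0 := by positivity
  have hne4 : H ^ δ ≠ 0 := by positivity
  have hlogQ : Real.log Q = k * (t * Real.log ((δ : ℝ) + 1)) + Real.log (D.factorial : ℝ) +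
      k * (δ * (2 * Real.log (2 + ‖x‖))) + δ * Real.log H := by
    rw [hQdef, Real.log_mul (mul_ne_zero (mul_ne_zero hne1 hne2) hne3) hne4,
      Real.log_mul (mul_ne_zero hne1 hne2) hne3, Real.log_mul hne1 hne2, e1, e2, e3]
  have hlogfact : Real.log (D.factorial : ℝ) ≤ D * Real.log ((D : ℝ) + 1) := by
    have h1 : (D.factorial : ℝ) ≤ ((D : ℝ) + 1) ^ D := by
      have := Nat.factorial_le_pow D
      calc (D.factorial : ℝ) ≤ ((D ^ D : ℕ) : ℝ) := by exact_mod_cast this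
        _ = (D : ℝ) ^ D := by push_cast; ring
        _ ≤ ((D : ℝ) + 1) ^ D := pow_le_pow_left₀ (by positivity) (by linarith) _
    calc Real.log (D.factorial : ℝ) ≤ Real.log (((D : ℝ) + 1) ^ D) :=
          Real.log_le_log (by positivity) h1
      _ = D * Real.log ((D : ℝ) + 1) := by rw [Real.log_pow]
  -- nonnegativity of the logarithms
  have hL1 : 0 ≤ Real.log ((δ : ℝ) + 1) := Real.log_nonneg (by linarith [(Nat.cast_nonneg δ : (0:ℝ) ≤ δ)])
  have hL12 : Real.log ((δ : ℝ) + 1) ≤ Real.log ((δ : ℝ) + 2) :=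
    Real.log_le_log (by positivity) (by linarith)
  have hL2 : 0 ≤ Real.log (2 + ‖x‖) := Real.log_nonneg (by linarith [norm_nonneg x])
  have hLH : 0 ≤ Real.log H := Real.log_nonneg hH1
  have hLD : 0 ≤ Real.log ((D : ℝ) + 1) := Real.log_nonneg (by linarith [(Nat.cast_nonneg D : (0:ℝ) ≤ D)])
  have hk0 : (0 : ℝ) ≤ k := Nat.cast_nonneg k
  have hδ0 : (0 : ℝ) ≤ δ := Nat.cast_nonneg δ
  have ht1 : (1 : ℝ) ≤ t := by exact_mod_cast ht
  have hmle : mreal ≤ m := by rw [hmdef]; exact Nat.le_ceil mreal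
  -- the height term is `logHeight (1 : β)`
  have hLHeq : Real.log H = logHeight (Fin.cons (1 : K) β : Fin (t + 1) → K) := rfl
  -- assemble
  have hfin : mreal * Real.log (1 / r) ≤
      k * (t * Real.log ((δ : ℝ) + 1)) + D * Real.log ((D : ℝ) + 1) +
        k * (δ * (2 * Real.log (2 + ‖x‖))) + δ * Real.log H := by
    have := mul_le_mul_of_nonneg_right hmle hlogr
    linarith [hlog1, hlogQ, hlogfact]
  have ht0 : (0 : ℝ) ≤ t := by positivity
  have hT1 : (t : ℝ) * Real.log ((δ : ℝ) + 1) ≤ (2 * t + 2) * Real.log ((δ : ℝ) + 2) := by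
    have h1 := mul_nonneg (by positivity : (0 : ℝ) ≤ 2 * t + 2) (sub_nonneg.mpr hL12)
    have h2 := mul_nonneg (by positivity : (0 : ℝ) ≤ t + 2) hL1
    linarith
  have hT1k : (k : ℝ) * ((t : ℝ) * Real.log ((δ : ℝ) + 1)) ≤ k * ((2 * t + 2) * Real.log ((δ : ℝ) + 2)) :=
    mul_le_mul_of_nonneg_left hT1 hk0
  have hT2 : (D : ℝ) * Real.log ((D : ℝ) + 1) ≤ (2 * t + 2) * (D * Real.log ((D : ℝ) + 1)) := by
    have h0 : 0 ≤ (D : ℝ) * Real.log ((D : ℝ) + 1) := by positivity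
    have h1 := mul_nonneg (by positivity : (0 : ℝ) ≤ 2 * t + 1) h0
    linarith
  have hT3 : (k : ℝ) * (δ * (2 * Real.log (2 + ‖x‖))) ≤ (2 * t + 2) * (k * δ * Real.log (2 + ‖x‖)) := by
    have h0 : 0 ≤ (k : ℝ) * δ * Real.log (2 + ‖x‖) := by positivity
    have h1 := mul_nonneg ht0 h0
    linarith
  have hT4 : (δ : ℝ) * Real.log H ≤ (2 * t + 2) * (δ * Real.log H) := by
    have h0 : 0 ≤ (δ : ℝ) * Real.log H := by positivity
    have h1 := mul_nonneg (by positivity : (0 : ℝ) ≤ 2 * t + 1) h0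
    linarith
  have hkT : (k : ℝ) * ((2 * t + 2) * Real.log ((δ : ℝ) + 2)) = (2 * t + 2) * (k * Real.log ((δ : ℝ) + 2)) := by
    ring
  -- the goal is stated with `mreal`, `D` (abbreviations introduced above); turn `logHeight` into `log H`
  rw [← hLHeq]
  linarith [hfin, hT1k, hT2, hT3, hT4, hkT]


end Summit.Schanuel.Schanuel.Cruxes.ApproximationProperty.OrbitInterpolationDeterminant

end
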